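import Summits.MatrixMultiplication.OmegaCensus.STPPSmallPatternT1K13OrderLaw110

/-!
# ω-census, small pattern `(2,1,1)¹³`: the `T1` order law LOWERED to `109` — every finite abelian group of order `≥ 109` hosts `(2,1,1)¹³`

Cell `pub-omega`, ω construction census, seat pub-omega ENG2 (gen 39), 2026-08-30.  HONEST FRAMING (verbatim): lottery ticket; floor = certified
bounds/negative ranges.  Census STRUCTURE bookkeeping (row B5 / conjecture C10 column `T1` at `k = 13`); nothing here bears on `ω`.

The law of record `exists_isSTPP_211pow13_of_card_ge_110` (`STPPSmallPatternT1K13OrderLaw110`) covers every finite abelian group of order `≥ 110`,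
and the cyclic column is gap-free from `108` (`exists_isSTPP_211pow13_zmod109`, `…zmod108`, `STPPSmallPatternT1K13LowHosts`).  Since `109` is prime,
a group of order `109` has an element of additive order `109` (Cauchy), so `exists_isSTPP_211pow13_of_addOrderOf_ge108` applies and the law drops to
`109` with no new search.  It does NOT drop to `108` here: of the six abelian types of order `108` only `ℤ/108`, `ℤ/18 × ℤ/6` and `ℤ/4 × (ℤ/3)³` are hosts
in the tree (`…T1K13Order108Hosts`); `[27,2,2]`, `[9,4,3]`, `[3,3,3,2,2]` are open (prereg P-137).
References: H. Cohn, R. Kleinberg, B. Szegedy, C. Umans, FOCS 2005 (arXiv:math/0511460), Def. 5.1.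
-/

open Literature.Computability.AlgebraicComplexity Finset

namespace Summit.MatrixMultiplication.OmegaCensus

/-- A finite additive group of prime order `109` has an element of additive order `109` (Cauchy). [folklore] -/
theorem exists_addOrderOf_eq_109_of_card_eq_109 {G : Type*} [AddCommGroup G] [Finite G] (hG : Nat.card G = 109) :
    ∃ g : G, addOrderOf g = 109 := by
  haveI : Fact (Nat.Prime 109) := ⟨by norm_num⟩
  exact exists_prime_addOrderOf_dvd_card' (G := G) 109 (by rw [hG])

/-- **THE `k = 13` LAW AT `109`: every finite abelian group of order `≥ 109` admits an STPP family of size pattern `(2,1,1)¹³`** (CKSU Def. 5.1,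
tree `IsSTPP`).  Order `≥ 110`: the law of record; order `= 109`: an element of order `109` and the transport lemma
`exists_isSTPP_211pow13_of_addOrderOf_ge108`.  No `ω` bound follows; `109` is not claimed sharp (three order-108 types open).
[cite: CohnKleinbergSzegedyUmans2005, Def. 5.1] -/
theorem exists_isSTPP_211pow13_of_card_ge_109 {G : Type*} [AddCommGroup G] [Finite G] (hG : 109 ≤ Nat.card G) :
    ∃ A B C : Fin 13 → Finset G, IsSTPP A B C ∧ ∀ i, (A i).card = 2 ∧ (B i).card = 1 ∧ (C i).card = 1 := by
  by_cases h : 110 ≤ Nat.card G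
  · exact exists_isSTPP_211pow13_of_card_ge_110 h
  · obtain ⟨g, hg⟩ := exists_addOrderOf_eq_109_of_card_eq_109 (G := G) (by omega)
    exact exists_isSTPP_211pow13_of_addOrderOf_ge108 g (by omega)

/-- `Nat.card`-monotone form for the census tables: `109 ≤ n ≤ Nat.card G` ⇒ host. [cite: CohnKleinbergSzegedyUmans2005, Def. 5.1] -/
theorem exists_isSTPP_211pow13_of_le_card109 {G : Type*} [AddCommGroup G] [Finite G] {n : ℕ} (hn : 109 ≤ n) (hG : n ≤ Nat.card G) :
    ∃ A B C : Fin 13 → Finset G, IsSTPP A B C ∧ ∀ i, (A i).card = 2 ∧ (B i).card = 1 ∧ (C i).card = 1 :=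
  exists_isSTPP_211pow13_of_card_ge_109 (le_trans hn hG)

end Summit.MatrixMultiplication.OmegaCensus
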